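import Summits.CriticalPhenomena.PercolationContinuityZ3.Theorems.PercNearOneGluingNoHeavyLowerTailRootedSequentialSlack
import HarnessLib

/-!
# `NoHeavyLowerTail` (stmt-CriticalPhenomena-4575) — the rooted exchange in SIGNED (product) form

Support file (prover `prim-hp-3`, hull-port line; `--supports stmt-CriticalPhenomena-4575`).  No definitions, no named facts, no sorries.

`HullPort.coreExchange_signed` — for `p ≠ t` and every `v`, with `D = {p ↮ t}`, `R_x = {|π(x)| ≤ j}`, `a = μ(D, p↔v, R_p, ¬R_t)`, `c = μ(D, p↔v, R_t, ¬R_p)`,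
`b = μ(D, R_t, ¬R_p)`:   `(a − c)·b ≤ c·(I(p) − I(t))`.
This keeps the exchange slack when `t` dominates `p` (then the right side is `≤ 0` and `a ≤ c − c(I(t) − I(p))/b`), which the `[·]⁺` form `coreExchange_slack` discards; it is the
ingredient of the tight glued-face bound `Δ'` of the crux notes (`HULLPORT-REF-gen6.md` §18: with it the one-level criterion still needs the deleted face's own slack, so the closure is
multi-level, observed depth ≤ 3).  [BHK 2006 Thm 1.5 via `twoClusterExchange`, as in `coreExchange`.]
-/

noncomputable section

namespace Summit.CriticalPhenomena.PercolationContinuityZ3.Theorems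

open MeasureTheory Set Literature.Probability.LatticeModels Literature.Probability.Percolation
open scoped Classical BigOperators

variable {n : ℕ}

namespace HullPort

/-- **Three-vertex exchange, signed product form.**  `p ≠ t`: with `D = {p ↮ t}`,
`(μ(D, p↔v, R_p, ¬R_t) − μ(D, p↔v, R_t, ¬R_p)) · μ(D, R_t, ¬R_p) ≤ μ(D, p↔v, R_t, ¬R_p) · (I(p) − I(t))`.
[cite: VandenbergHaggstromKahn2005, Thm. 1.5 (p. 7) — via `twoClusterExchange`; this work] -/
theorem coreExchange_signed (w : Sym2 (Fin n) → unitInterval) (A : Finset (Fin n)) (p t v : Fin n) (j : ℕ) (hpt : p ≠ t) :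
    ((prodBernoulli w).real ((openConn p t : Set (BondConfig (Fin n)))ᶜ ∩ ((openConn p v : Set (BondConfig (Fin n))) ∩
        ({ω : BondConfig (Fin n) | (A.filter fun z => ω ∈ openConn p z).card ≤ j} ∩
          {ω : BondConfig (Fin n) | (A.filter fun z => ω ∈ openConn t z).card ≤ j}ᶜ))) -
      (prodBernoulli w).real ((openConn p t : Set (BondConfig (Fin n)))ᶜ ∩ ((openConn p v : Set (BondConfig (Fin n))) ∩
        ({ω : BondConfig (Fin n) | (A.filter fun z => ω ∈ openConn t z).card ≤ j} ∩
          {ω : BondConfig (Fin n) | (A.filter fun z => ω ∈ openConn p z).card ≤ j}ᶜ)))) *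
      (prodBernoulli w).real ((openConn p t : Set (BondConfig (Fin n)))ᶜ ∩
        ({ω : BondConfig (Fin n) | (A.filter fun z => ω ∈ openConn t z).card ≤ j} ∩
          {ω : BondConfig (Fin n) | (A.filter fun z => ω ∈ openConn p z).card ≤ j}ᶜ)) ≤
      (prodBernoulli w).real ((openConn p t : Set (BondConfig (Fin n)))ᶜ ∩ ((openConn p v : Set (BondConfig (Fin n))) ∩
        ({ω : BondConfig (Fin n) | (A.filter fun z => ω ∈ openConn t z).card ≤ j} ∩
          {ω : BondConfig (Fin n) | (A.filter fun z => ω ∈ openConn p z).card ≤ j}ᶜ))) *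
      ((prodBernoulli w).real {ω : BondConfig (Fin n) | (A.filter fun z => ω ∈ openConn p z).card ≤ j} -
        (prodBernoulli w).real {ω : BondConfig (Fin n) | (A.filter fun z => ω ∈ openConn t z).card ≤ j}) := by
  set μ := prodBernoulli w with hμ
  set D : Set (BondConfig (Fin n)) := (openConn p t : Set (BondConfig (Fin n)))ᶜ with hD
  set Rp := {ω : BondConfig (Fin n) | (A.filter fun z => ω ∈ openConn p z).card ≤ j} with hRp
  set Rt := {ω : BondConfig (Fin n) | (A.filter fun z => ω ∈ openConn t z).card ≤ j} with hRt
  set X : Set (BondConfig (Fin n)) := (openConn p v : Set (BondConfig (Fin n))) with hX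
  have hmeas : ∀ S : Set (BondConfig (Fin n)), MeasurableSet S := fun S => (Set.toFinite S).measurableSet
  have key := twoClusterExchange w hpt (A₁ := X) (A₂ := Rt ∩ Rpᶜ) (B₁ := Rp ∩ Rtᶜ) (B₂ := (univ : Set (BondConfig (Fin n))))
    (fun ω ω' hs ht hω => typePlus_openConn p t v hs ht hω)
    (fun ω ω' hs ht hω => ⟨LonelyClusterExchange.typePlus_card_le A j p t hs ht hω.1,
      fun h' => hω.2 (LonelyClusterExchange.typeMinus_card_le A j p t hs ht h')⟩)
    (fun ω ω' hs ht hω => ⟨LonelyClusterExchange.typeMinus_card_le A j p t hs ht hω.1,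
      fun h' => hω.2 (LonelyClusterExchange.typePlus_card_le A j p t hs ht h')⟩)
    (fun _ _ _ _ _ => mem_univ _)
  simp only [inter_univ] at key
  have hsep := CutObserver.lightness_sub_eq_sep w A p t j
  have hcomm : (openConn t p : Set (BondConfig (Fin n))) = openConn p t := knThm2_openConn_comm t p
  rw [hcomm] at hsep
  have h1 : μ.real (D ∩ Rp ∩ Rt) + μ.real ((D ∩ Rp) \ Rt) = μ.real (D ∩ Rp) := measureReal_inter_add_sdiff (hmeas Rt)
  have h2 : μ.real (D ∩ Rt ∩ Rp) + μ.real ((D ∩ Rt) \ Rp) = μ.real (D ∩ Rt) := measureReal_inter_add_sdiff (hmeas Rp)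
  have e12 : D ∩ Rp ∩ Rt = D ∩ Rt ∩ Rp := by ext ω; simp only [mem_inter_iff]; tauto
  have eB : (D ∩ Rp) \ Rt = D ∩ (Rp ∩ Rtᶜ) := by ext ω; simp only [mem_inter_iff, mem_sdiff, mem_compl_iff]; tauto
  have eA : (D ∩ Rt) \ Rp = D ∩ (Rt ∩ Rpᶜ) := by ext ω; simp only [mem_inter_iff, mem_sdiff, mem_compl_iff]; tauto
  rw [e12] at h1
  rw [eB] at h1
  rw [eA] at h2
  have hdb : μ.real (D ∩ (Rp ∩ Rtᶜ)) - μ.real (D ∩ (Rt ∩ Rpᶜ)) = μ.real Rp - μ.real Rt := by linarith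
  -- `a b ≤ c d = c b + c (d - b)`
  have : μ.real (D ∩ (X ∩ (Rt ∩ Rpᶜ))) * μ.real (D ∩ (Rp ∩ Rtᶜ)) =
      μ.real (D ∩ (X ∩ (Rt ∩ Rpᶜ))) * μ.real (D ∩ (Rt ∩ Rpᶜ)) +
        μ.real (D ∩ (X ∩ (Rt ∩ Rpᶜ))) * (μ.real Rp - μ.real Rt) := by rw [← hdb]; ring
  nlinarith [key, this]

end HullPort

end Summit.CriticalPhenomena.PercolationContinuityZ3.Theorems

end
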